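/-
Copyright: the b2b-balaban cell (near-miss cell 7), T⁴-continuum fan-out; row NE7b ROUND-2 swarm, seat
t4-ne7b-formalise-leaf-10 (row S7 §0, ZONE form; owner's rulings R-OWNER-22-1 R2 and R-OWNER-22-9).
Released under the licence of the surrounding project.
-/
import Summits.QuantumFields.BalabanUV.T4Continuum.Support.HistorySocketTH
import Summits.QuantumFields.BalabanUV.T4Continuum.Support.HistoryZoneSurcharge

/-!
# The history socket in the ZONE currency (socket v3-Z): the tree-count socket over the Z-surcharge exit

Summits-side support leaf of the T⁴-continuum cell (rung (B)+1 on a FINITE torus only; NOT infinite volume, NOT the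
mass gap, NOT the Clay statement; NOT a proof of the spine estimate NE7b).  Row NE7b, route «COUNT», claim table
`t4/b2b-balaban-t4-ne7b-p1/LEAVES-NE7b.md` row S7 §0, seat `t4-ne7b-formalise-leaf-10`.  Companion of
`Support/HistorySocketTH` (p208411): the SAME socket with the member price stated in the (GM) ZONE currency — the full
multiplicity `Kz^{#merges}·∏Q(wcnt,σ,step)^p·Λ′^{partnerAges}` on the flat image `gmap sh G′` times the tagged raw factor
(exactly the right-hand side of `HistoryZoneSurcharge.relWeightBound_lateMergersZ_of_irThreshold`'s binder `hlabZTH`,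
row S6e, leaf-05, p208647) — so that row S6's `card_admZSet_le_of_readingS` feeds `price` DIRECTLY and the zone
surcharge is absorbed inside the exit (`lowerA` against the infrared floor), not by the supplier.  [folklore]
bookkeeping over the lineage's OWN carrier; nothing is quoted from print, nothing printed is asserted, no `[cite:]` tag,
no `Prop`-valued fact is minted (c1).

WHAT.  §1 `shapeZTH` (the exit's zone price, verbatim), `occShapesZ`∕`yZTH` (max-price of a branching slot, `sSup`),
**`structure LiveHistoriesZTH (sh) (Gx : ℕ → Gen ε → Prop) …`** over `live : ℕ → κ → Finset (γ × Gen ε)`: per live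
member `(z, G′)` at cutoff `K ≥ K₀` — `consistent` (`ConsistentT`), `fresh` (`FreshT`), `generic` (`Gx K G′`, an
ABSTRACT genericity predicate; the §3 END asks `Gx K G′ → Set.InjOn sh ↑G′.events`, the display of the Z exit v1; under
R-OWNER-22-9 it weakens to `BirthShapeNodup` when S6e part 2 lands — same structure, new END), `pending` (`K < reach`),
`cell_mem`, `canon`; per class — `old`, `slot_inj` (WITHIN the class), `price`∕`price′` (`F·Rf ≤ ∏ shapeZTH`); across
classes — `str_inj`.  §2 derived binders (`occShapesZ_finite`, `yZTH_nonneg`, `shapeZTH_le_yZTH`, `hlabZTH_of_live`,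
`hstrZ_of_live`, `hFZ_of_live`∕`hFZ'_of_live`; `BadFin`∕`bslotOf`∕`bstrOf`∕`InLiveTH` from `HistorySocketTH`).  §3
**`relWeightBound_of_liveHistoriesZTH`** = leaf-05's Z exit with its (ID) binders REPLACED by ONE `LiveHistoriesZTH`;
**`hybridNE7_of_liveHistoriesZTH`** via `CountSeamJunction.hybridNE7_of_eventually`.  §4 sanity (empty classes).

RESIDUAL (R-OWNER-22-9, displayed by the supplier, not hidden here): the product-form multiplicity is class-linearly
absorbable only for BIRTH-SHAPE-GENERIC members («equal-shape sibling crowds» are row S6g's symmetrised count); this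
socket carries the genericity as the field `generic`.  NE7b NOT proved; spine 0∕9.

HONEST DEPENDENCY (cell): continuum YM on T⁴ ⇐ BetaPertH ∧ nine spine estimates (0/9 proved); BetaPertH ⇐ (D1) ∧ (D4)
∧ CAP+tail.  This file changes none of it.
-/

open Finset
open Literature.MathematicalPhysics.QuantumFieldTheory.Balaban1983to89
open T4PersistenceDictionary T4PersistentHistoryCount T4BankedInduction T4PrintedShapeBanking T4PartnerMultiplicity
open T4WeightBudget T4GlobalDenominator T4LiveClassFibration T4LiveStructureGas T4LiveGasToTerms T4RecordPriceSeam
open T4BranchingRecordsGas T4TaggedShapeBanking T4CanonicalMenus T4CountHorizon T4MatchingClosureSocket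
open T4IndicatorShell T4MatchingAssembly T4MatchingClosure
open Summit.QuantumFields.BalabanUV.T4Continuum
open PlacementBatch PlacementSkeleton PartnerMultiplicityF PartnerMultiplicityG PartnerMultiplicityZ
open PartnerMultiplicityFloor PartnerMultiplicityThreshold Crowding CountThresholdUniform CountThresholdExit
open CountSeamJunction LateMergers ZoneSkeleton HistoryConsistent HistoryZoneSurcharge HistorySocketTH

namespace Summit.QuantumFields.BalabanUV.T4Continuum.HistorySocketZTH

noncomputable section

/-! ## §1 The zone price shape, the max-price, the socket -/

section Defs

variable {ε γ κ : Type*} [DecidableEq ε]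

/-- **THE Z EXIT'S PER-MEMBER PRICE SHAPE** — the right-hand side of `relWeightBound_lateMergersZ_of_irThreshold`'s
`hlabZTH` verbatim: `Δ·Kz^{#merges (gmap sh G′)}·∏Q(wcnt (gmap sh G′))^p·Λ′^{partnerAges}·e^{−credits}·e^{+lifeCost}`
(horizon `0`). [folklore] -/
def shapeZTH (sh : ε → PEv) (C : T4PrintedShapeBanking.Consts) (Kz p σ Λ' Δ : ℝ) (R : ℕ → ℕ → ℕ) (g : ℕ → ℕ → ℝ)
    (K : ℕ) (G : Gen ε) : ℝ :=
  Δ * (Kz ^ (merges (gmap sh G)).card *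
    (∏ e ∈ merges (gmap sh G), Crowding.Q (wcnt (gmap sh G)) σ e.step ^ p) *
    Λ' ^ partnerAges PEv.step (gmap sh G) * (Real.exp (-credits (credit C (g K) ∘ sh) G) *
      Real.exp (lifeCost (padW (dictWT sh (R K) C.n₁) 0) (costT sh C K (R K)) G)))

/-- the zone price shape is nonnegative (`Δ ≥ 0`, `Kz ≥ 1`, `σ ≥ 0`, `Λ′ ≥ 0`) [folklore] -/
theorem shapeZTH_nonneg {sh : ε → PEv} {C : T4PrintedShapeBanking.Consts} {Kz p σ Λ' Δ : ℝ} (hΔ : 0 ≤ Δ)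
    (hKz : 1 ≤ Kz) (hσ : 0 ≤ σ) (hΛ : 0 ≤ Λ') (R : ℕ → ℕ → ℕ) (g : ℕ → ℕ → ℝ) (K : ℕ) (G : Gen ε) :
    0 ≤ shapeZTH sh C Kz p σ Λ' Δ R g K G := by
  unfold shapeZTH
  refine mul_nonneg hΔ (mul_nonneg (mul_nonneg (mul_nonneg (pow_nonneg (zero_le_one.trans hKz) _)
    (prod_nonneg fun e he => ?_)) (pow_nonneg hΛ _)) (by positivity))
  exact Real.rpow_nonneg (zero_le_one.trans (one_le_Qw_of_mem hσ he)) _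

/-- the zone price shapes of the live occupants of a branching slot at cutoff `K` [folklore] -/
def occShapesZ (sh : ε → PEv) (C : T4PrintedShapeBanking.Consts) (Kz p σ Λ' Δ l₀ : ℝ) (R : ℕ → ℕ → ℕ)
    (g : ℕ → ℕ → ℝ) (Bad' : ℕ → ℝ → Finset κ) (live : ℕ → κ → Finset (γ × Gen ε)) (K : ℕ) (s : BSlot γ PEv) :
    Set ℝ :=
  {x | ∃ q : γ × Gen ε, InLiveTH l₀ Bad' live K q ∧ bslotOf sh q = s ∧ x = shapeZTH sh C Kz p σ Λ' Δ R g K q.2}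

/-- **THE ZONE MAX-PRICE OF A BRANCHING SLOT**: `sSup` of `{0} ∪` the occupants' zone shapes. [folklore] -/
def yZTH (sh : ε → PEv) (C : T4PrintedShapeBanking.Consts) (Kz p σ Λ' Δ l₀ : ℝ) (R : ℕ → ℕ → ℕ) (g : ℕ → ℕ → ℝ)
    (Bad' : ℕ → ℝ → Finset κ) (live : ℕ → κ → Finset (γ × Gen ε)) (K j : ℕ) (z : γ) (G : Gen PEv) : ℝ :=
  sSup (insert 0 (occShapesZ sh C Kz p σ Λ' Δ l₀ R g Bad' live K ⟨j, z, G⟩))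

variable [DecidableEq γ]

/-- **THE HISTORY SOCKET IN THE ZONE CURRENCY.**  As `HistorySocketTH.LiveHistoriesTH` at horizon `0`, with an
abstract per-member genericity predicate `Gx` and the member price in the Z exit's currency. [folklore] -/
structure LiveHistoriesZTH (sh : ε → PEv) (Gx : ℕ → Gen ε → Prop) (C : T4PrintedShapeBanking.Consts)
    (Kz p σ Λ' Δ : ℝ) (l₀ : ℝ) (K₀ : ℕ) (R : ℕ → ℕ → ℕ) (g : ℕ → ℕ → ℝ) (Cell : ℕ → ℕ → Finset γ)
    (Dcap Ncap : ℕ → ℕ) (jstar : ℕ → ℕ) (Bad' : ℕ → ℝ → Finset κ) (F Rf F' Rf' : ℕ → κ → ℝ)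
    (live : ℕ → κ → Finset (γ × Gen ε)) : Prop where
  /-- (H2b) live members are consistent at their cutoff -/
  consistent : ∀ K q, K₀ ≤ K → InLiveTH l₀ Bad' live K q → ConsistentT sh C K (R K) q.2
  /-- (H2b) … their tags are fresh -/
  fresh : ∀ K q, K₀ ≤ K → InLiveTH l₀ Bad' live K q → FreshT q.2
  /-- (H2b) … they satisfy the genericity predicate (for the Z exit v1: shape-injective events) -/
  generic : ∀ K q, K₀ ≤ K → InLiveTH l₀ Bad' live K q → Gx K q.2
  /-- (H2b) … and they are pending at the cutoff -/
  pending : ∀ K q, K₀ ≤ K → InLiveTH l₀ Bad' live K q → K < q.2.reach (dictWT sh (R K) C.n₁)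
  /-- (H2e) the root cell is a cell of the root's age -/
  cell_mem : ∀ K q, K₀ ≤ K → InLiveTH l₀ Bad' live K q → q.1 ∈ Cell K (K - q.2.rootStep)
  /-- (H2e) the shape tree is a record of the canonical run of its slot -/
  canon : ∀ K q, K₀ ≤ K → InLiveTH l₀ Bad' live K q → relabel (shape ∘ sh) q.2 ∈ canonFam Dcap Ncap K q.2.rootStep
  /-- (H2e) every bad class has an OLD live member -/
  old : ∀ K t, |t| ≤ l₀ → K₀ ≤ K → ∀ c ∈ Bad' K t, ∃ q ∈ live K c, q.2.rootStep < jstar K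
  /-- (H2e) WITHIN a class, distinct live members occupy distinct branching slots -/
  slot_inj : ∀ K t, |t| ≤ l₀ → K₀ ≤ K → ∀ c ∈ Bad' K t, Set.InjOn (bslotOf sh) (live K c : Set (γ × Gen ε))
  /-- (H2e) distinct bad classes have distinct branching slot families -/
  str_inj : ∀ K t, |t| ≤ l₀ → K₀ ≤ K → Set.InjOn (bstrOf sh live K) (Bad' K t)
  /-- (P) run A: the class price is dominated by the product of the members' zone price shapes -/
  price : ∀ K t, |t| ≤ l₀ → K₀ ≤ K → ∀ c ∈ Bad' K t,
    F K c * Rf K c ≤ ∏ q ∈ live K c, shapeZTH sh C Kz p σ Λ' Δ R g K q.2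
  /-- (P) run A′: the same -/
  price' : ∀ K t, |t| ≤ l₀ → K₀ ≤ K → ∀ c ∈ Bad' K t,
    F' K c * Rf' K c ≤ ∏ q ∈ live K c, shapeZTH sh C Kz p σ Λ' Δ R g K q.2

end Defs

/-! ## §2 The (ID) binders of the Z exit, DERIVED -/

section Derived

variable {ε γ κ : Type*} [DecidableEq ε] {sh : ε → PEv} {Gx : ℕ → Gen ε → Prop} {C : T4PrintedShapeBanking.Consts}
  {Kz p σ Λ' Δ l₀ : ℝ} {K₀ : ℕ} {R : ℕ → ℕ → ℕ} {g : ℕ → ℕ → ℝ} {Cell : ℕ → ℕ → Finset γ} {Dcap Ncap : ℕ → ℕ}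
  {jstar : ℕ → ℕ} {Bad' : ℕ → ℝ → Finset κ} {F Rf F' Rf' : ℕ → κ → ℝ} {live : ℕ → κ → Finset (γ × Gen ε)}

/-- with finitely many bad classes, a branching slot has finitely many occupant zone shapes [folklore] -/
theorem occShapesZ_finite {K : ℕ} (hfin : BadFin l₀ Bad' K) (s : BSlot γ PEv) :
    (occShapesZ sh C Kz p σ Λ' Δ l₀ R g Bad' live K s).Finite := by
  obtain ⟨Bs, hBs⟩ := hfin
  have hU : (⋃ c ∈ (Bs : Set κ), (live K c : Set (γ × Gen ε))).Finite :=
    Bs.finite_toSet.biUnion fun c _ => (live K c).finite_toSet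
  refine ((hU.image fun q : γ × Gen ε => shapeZTH sh C Kz p σ Λ' Δ R g K q.2).subset ?_)
  rintro x ⟨q, ⟨t, ht, c, hc, hq⟩, -, rfl⟩
  exact ⟨q, Set.mem_iUnion₂.2 ⟨c, hBs t ht hc, hq⟩, rfl⟩

/-- the zone max-price is nonnegative (every cutoff) [folklore] -/
theorem yZTH_nonneg (K j : ℕ) (z : γ) (G : Gen PEv) : 0 ≤ yZTH sh C Kz p σ Λ' Δ l₀ R g Bad' live K j z G := by
  unfold yZTH
  by_cases h : BddAbove (insert 0 (occShapesZ sh C Kz p σ Λ' Δ l₀ R g Bad' live K ⟨j, z, G⟩))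
  · exact le_csSup h (Set.mem_insert _ _)
  · rw [Real.sSup_of_not_bddAbove h]

/-- a live occupant's zone shape is at most its slot's zone max-price [folklore] -/
theorem shapeZTH_le_yZTH {K : ℕ} (hfin : BadFin l₀ Bad' K) {q : γ × Gen ε} (hq : InLiveTH l₀ Bad' live K q) :
    shapeZTH sh C Kz p σ Λ' Δ R g K q.2 ≤
      yZTH sh C Kz p σ Λ' Δ l₀ R g Bad' live K q.2.rootStep q.1 (relabel (shape ∘ sh) q.2) :=
  le_csSup ((occShapesZ_finite hfin _).insert 0).bddAbove (Set.mem_insert_of_mem _ ⟨q, hq, rfl, rfl⟩)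

/-- the suppliers' tool in the zone currency: a slot-injective finite family of live members has product of zone shapes
at most the family weight of its slot image [folklore] -/
theorem prod_shapeZTH_le_famWeight [DecidableEq γ] (hΔ : 0 ≤ Δ) (hKz : 1 ≤ Kz) (hσ : 0 ≤ σ) (hΛ : 0 ≤ Λ')
    {K : ℕ} (hfin : BadFin l₀ Bad' K) {S : Finset (γ × Gen ε)} (hS : ∀ q ∈ S, InLiveTH l₀ Bad' live K q)
    (hinj : Set.InjOn (bslotOf sh) (S : Set (γ × Gen ε))) :
    ∏ q ∈ S, shapeZTH sh C Kz p σ Λ' Δ R g K q.2 ≤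
      famWeight (bslotPrice (yZTH sh C Kz p σ Λ' Δ l₀ R g Bad' live K)) (S.image (bslotOf sh)) := by
  rw [famWeight, prod_image hinj]
  refine prod_le_prod (fun q _ => shapeZTH_nonneg hΔ hKz hσ hΛ R g K _) fun q hq => ?_
  simp only [bslotOf, bslotPrice]
  exact shapeZTH_le_yZTH hfin (hS q hq)

variable [DecidableEq γ]

/-- **`hlabZTH` FROM THE SOCKET** (the Z exit v1's form: genericity `Set.InjOn sh ↑G′.events` obtained from `Gx`).
[folklore] -/
theorem hlabZTH_of_live
    (H : LiveHistoriesZTH sh Gx C Kz p σ Λ' Δ l₀ K₀ R g Cell Dcap Ncap jstar Bad' F Rf F' Rf' live)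
    (hGx : ∀ K G', Gx K G' → Set.InjOn sh (G'.events : Set ε))
    (hfin : ∀ K, K₀ ≤ K → BadFin l₀ Bad' K)
    (K : ℕ) (hK : K₀ ≤ K) (j : ℕ) (_hj : j ≤ K) (z : γ) (_hz : z ∈ Cell K (K - j)) (G : Gen PEv)
    (_hG : G ∈ canonFam Dcap Ncap K j) :
    yZTH sh C Kz p σ Λ' Δ l₀ R g Bad' live K j z G ≤ 0 ∨
      ∃ G' : Gen ε, ConsistentT sh C K (R K) G' ∧ FreshT G' ∧ Set.InjOn sh ↑G'.events ∧
        K < G'.reach (dictWT sh (R K) C.n₁) ∧ relabel (shape ∘ sh) G' = G ∧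
        yZTH sh C Kz p σ Λ' Δ l₀ R g Bad' live K j z G ≤ Δ * (Kz ^ (merges (gmap sh G')).card *
          (∏ e ∈ merges (gmap sh G'), Crowding.Q (wcnt (gmap sh G')) σ e.step ^ p) *
          Λ' ^ partnerAges PEv.step (gmap sh G') * (Real.exp (-credits (credit C (g K) ∘ sh) G') *
            Real.exp (lifeCost (padW (dictWT sh (R K) C.n₁) 0) (costT sh C K (R K)) G'))) := by
  have hne : (insert (0 : ℝ) (occShapesZ sh C Kz p σ Λ' Δ l₀ R g Bad' live K ⟨j, z, G⟩)).Nonempty :=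
    ⟨0, Set.mem_insert _ _⟩
  have hmem := hne.csSup_mem ((occShapesZ_finite (hfin K hK) _).insert 0)
  rcases Set.mem_insert_iff.1 hmem with h0 | hS
  · left
    unfold yZTH
    exact le_of_eq h0
  · right
    obtain ⟨q, hin, hslot, hx⟩ := hS
    simp only [bslotOf, Sigma.mk.inj_iff, heq_eq_eq] at hslot
    obtain ⟨rfl, rfl, rfl⟩ := hslot
    refine ⟨q.2, H.consistent K q hK hin, H.fresh K q hK hin, hGx K q.2 (H.generic K q hK hin),
      H.pending K q hK hin, rfl, ?_⟩
    unfold yZTH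
    rw [hx]
    exact le_of_eq rfl

/-- **`hstr` FROM THE SOCKET** (zone form): live branching slots, one of them old. [folklore] -/
theorem hstrZ_of_live (H : LiveHistoriesZTH sh Gx C Kz p σ Λ' Δ l₀ K₀ R g Cell Dcap Ncap jstar Bad' F Rf F' Rf' live)
    (K : ℕ) (t : ℝ) (ht : |t| ≤ l₀) (hK : K₀ ≤ K) :
    ∀ c ∈ Bad' K t, bstrOf sh live K c ⊆ bliveSlots Cell (canonFam Dcap Ncap) K ∧
      ∃ o ∈ boldSlots Cell (canonFam Dcap Ncap) jstar K, o ∈ bstrOf sh live K c := by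
  intro c hc
  refine ⟨fun s hs => ?_, ?_⟩
  · obtain ⟨q, hq, rfl⟩ := mem_image.1 hs
    have hin : InLiveTH l₀ Bad' live K q := ⟨t, ht, c, hc, hq⟩
    simp only [bliveSlots, bslotOf, mem_sigma, mem_range]
    exact ⟨Nat.lt_succ_of_le (consistentT_rootStep_le (H.consistent K q hK hin)), H.cell_mem K q hK hin,
      H.canon K q hK hin⟩
  · obtain ⟨q, hq, hold⟩ := H.old K t ht hK c hc
    have hin : InLiveTH l₀ Bad' live K q := ⟨t, ht, c, hc, hq⟩
    refine ⟨bslotOf sh q, ?_, mem_image_of_mem _ hq⟩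
    simp only [boldSlots, bslotOf, mem_sigma, mem_range]
    exact ⟨hold, H.cell_mem K q hK hin, H.canon K q hK hin⟩

/-- **`hF` FROM THE SOCKET** (zone form). [folklore] -/
theorem hFZ_of_live (hΔ : 0 ≤ Δ) (hKz : 1 ≤ Kz) (hσ : 0 ≤ σ) (hΛ : 0 ≤ Λ')
    (H : LiveHistoriesZTH sh Gx C Kz p σ Λ' Δ l₀ K₀ R g Cell Dcap Ncap jstar Bad' F Rf F' Rf' live)
    {K : ℕ} (hfin : BadFin l₀ Bad' K) (t : ℝ) (ht : |t| ≤ l₀) (hK : K₀ ≤ K) :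
    ∀ c ∈ Bad' K t,
      F K c * Rf K c ≤ famWeight (bslotPrice (yZTH sh C Kz p σ Λ' Δ l₀ R g Bad' live K)) (bstrOf sh live K c) :=
  fun c hc => (H.price K t ht hK c hc).trans
    (prod_shapeZTH_le_famWeight hΔ hKz hσ hΛ hfin (fun _ hq => ⟨t, ht, c, hc, hq⟩) (H.slot_inj K t ht hK c hc))

/-- … and `hF′`. [folklore] -/
theorem hFZ'_of_live (hΔ : 0 ≤ Δ) (hKz : 1 ≤ Kz) (hσ : 0 ≤ σ) (hΛ : 0 ≤ Λ')
    (H : LiveHistoriesZTH sh Gx C Kz p σ Λ' Δ l₀ K₀ R g Cell Dcap Ncap jstar Bad' F Rf F' Rf' live)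
    {K : ℕ} (hfin : BadFin l₀ Bad' K) (t : ℝ) (ht : |t| ≤ l₀) (hK : K₀ ≤ K) :
    ∀ c ∈ Bad' K t,
      F' K c * Rf' K c ≤ famWeight (bslotPrice (yZTH sh C Kz p σ Λ' Δ l₀ R g Bad' live K)) (bstrOf sh live K c) :=
  fun c hc => (H.price' K t ht hK c hc).trans
    (prod_shapeZTH_le_famWeight hΔ hKz hσ hΛ hfin (fun _ hq => ⟨t, ht, c, hc, hq⟩) (H.slot_inj K t ht hK c hc))

end Derived

/-! ## §3 The Z exit and the seam over the socket -/

section Exit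

variable {ε γ κ ι : Type*} [DecidableEq ε] [DecidableEq γ] [DecidableEq κ] [DecidableEq ι] {l₀ vol : ℝ} {K₀ : ℕ}
  {π : ℕ → ι → κ} {T : ℕ → Finset ι} {A A' shA shB : ℕ → ℝ → ι → ℝ} {Bad' : ℕ → ℝ → Finset κ}
  {dead dead' : ℕ → ℝ → ι → ℝ} {F Rf F' Rf' : ℕ → κ → ℝ} {nlow nup mlow mup : ℕ → ℝ → ℝ} {Cn : ℝ}
  {Cc Rr CcRec RrRec : ℕ → ℝ → ι → ℝ} {ν u s₂ c₀ r s Wsh : ℕ → ℝ}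

omit [DecidableEq ι] in
/-- **NE7b's TREE-COUNT EXIT IN THE ZONE CURRENCY OVER THE SOCKET.**
`HistoryZoneSurcharge.relWeightBound_lateMergersZ_of_irThreshold` with its (ID) binders (`y`∕`hy0`∕`hlabZTH`, `str`∕`hinj`∕
`hstr`, `hF`, `hF′`) REPLACED by ONE `LiveHistoriesZTH` hypothesis whose genericity predicate implies shape-injective
events; every other binder verbatim; conclusion unchanged. [folklore] -/
theorem relWeightBound_of_liveHistoriesZTH (sh : ε → PEv) {Gx : ℕ → Gen ε → Prop}
    (hGx : ∀ K G', Gx K G' → Set.InjOn sh (G'.events : Set ε))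
    {C : T4PrintedShapeBanking.Consts} {L rr : ℕ} {β₀ : ℝ} (h : ThresholdOK C L rr β₀) (hμ₀ : 0 < C.μ)
    {Kz p σ ε' θ : ℝ} (hKz : 1 ≤ Kz) (hp : 0 ≤ p) (h0 : 0 < σ) (h1σ : σ < 1) (hε : 0 < ε') (hθ : 0 < θ)
    (Cell : ℕ → ℕ → Finset γ) {V Λ : ℝ} (hV : 0 ≤ V) (hΛ : 0 < Λ)
    (hcell : ∀ K a, ((Cell K a).card : ℝ) ≤ V * Λ ^ a) (Dcap Ncap : ℕ → ℕ)
    (jstar : ℕ → ℕ) (hj : ∀ K, jstar K ≤ K) {c : ℝ} (hc : 0 < c)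
    (hfrac : ∀ K : ℕ, c * K ≤ ((K - jstar K : ℕ) : ℝ)) {Δ : ℝ} (hΔ : 1 ≤ Δ)
    (hA : Regeneration l₀ π T A Bad' dead F Rf nlow nup Cn K₀)
    (hA' : Regeneration l₀ π T A' Bad' dead' F' Rf' mlow mup Cn K₀) (hCn : 0 ≤ Cn)
    (R : ℕ → ℕ → ℕ) (g : ℕ → ℕ → ℝ) (β' : ℕ → ℝ)
    (h27 : ∀ K, K₀ ≤ K → B14.FlowIneq27 (g K) (β' K) β₀ C.p₀ K)
    (h29 : ∀ K, K₀ ≤ K → B14FlowStep.FlowIneq29 (R K) (g K) L (β' K) β₀ K)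
    (hR : ∀ K, K₀ ≤ K → ∀ s, s ≤ K → B14.IsRj L rr (g K s) (R K s))
    (hx1 : ∀ K, K₀ ≤ K → ∀ s, s ≤ K → 1 ≤ Real.log ((g K s) ^ 2)⁻¹)
    (hir : ∀ K, K₀ ≤ K → irThresholdZTH sh C Kz p σ ε' θ L rr β₀ ≤ Real.log ((g K K) ^ 2)⁻¹)
    (hP : ∀ K s, 0 ≤ p0Profile C.A₀ C.p₀ (g K s))
    {ηplus : ℝ} (hηplus : 0 ≤ ηplus) (hr : Λ * Real.exp (ηplus - C.κ₁) < 1)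
    {Λ' : ℝ} (hΛ0 : 0 ≤ Λ') (h1 : Λ' * Real.exp ε' * Real.exp (-C.κ₁) * Real.exp ηplus < 1)
    (hx : (Real.exp (-C.E₀) + Real.exp (-C.E₀) * birthMass C *
          (Λ' * Real.exp ε' * Real.exp (-C.κ₁) / (1 - Λ' * Real.exp ε' * Real.exp (-C.κ₁) * Real.exp ηplus))) *
          Real.exp ηplus ≤
        Real.exp ηplus - 1)
    {live : ℕ → κ → Finset (γ × Gen ε)}
    (H : LiveHistoriesZTH sh Gx C Kz p σ Λ' Δ l₀ K₀ R g Cell Dcap Ncap jstar Bad' F Rf F' Rf' live) :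
    ∃ K₁, K₀ ≤ K₁ ∧ RelWeightBound l₀ T A A' (fun K t => if K₁ ≤ K then badOfClass π T Bad' K t else ∅)
      (Set.indicator {K | K₁ ≤ K}
        (fun K => Cn * recordsBudget (Δ * Real.exp (C.κ₁ * ((0 : ℕ) : ℝ)) * birthMass C) C.κ₁ V Λ ηplus jstar K)) :=
  have hΔ0 : (0 : ℝ) ≤ Δ := zero_le_one.trans hΔ
  relWeightBound_lateMergersZ_of_irThreshold sh h hμ₀ hKz hp h0 h1σ hε hθ Cell hV hΛ hcell Dcap Ncap jstar hj hc hfrac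
    hΔ hA hA' hCn R g β' h27 h29 hR hx1 hir hP hηplus hr hΛ0 h1 hx (yZTH sh C Kz p σ Λ' Δ l₀ R g Bad' live)
    (fun K j _ z _ G _ => yZTH_nonneg K j z G)
    (hlabZTH_of_live H hGx fun _ hK => badFin_of_regeneration hA hK) (bstrOf sh live) (H.str_inj)
    (hstrZ_of_live H) (fun _ t ht hK => hFZ_of_live hΔ0 hKz h0.le hΛ0 H (badFin_of_regeneration hA hK) t ht hK)
    (fun _ t ht hK => hFZ'_of_live hΔ0 hKz h0.le hΛ0 H (badFin_of_regeneration hA hK) t ht hK)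

/-- **… AND INTO THE SEAM** (`CountSeamJunction.hybridNE7_of_eventually`). [folklore] -/
theorem hybridNE7_of_liveHistoriesZTH (sh : ε → PEv) {Gx : ℕ → Gen ε → Prop}
    (hGx : ∀ K G', Gx K G' → Set.InjOn sh (G'.events : Set ε))
    {C : T4PrintedShapeBanking.Consts} {L rr : ℕ} {β₀ : ℝ} (h : ThresholdOK C L rr β₀) (hμ₀ : 0 < C.μ)
    {Kz p σ ε' θ : ℝ} (hKz : 1 ≤ Kz) (hp : 0 ≤ p) (h0 : 0 < σ) (h1σ : σ < 1) (hε : 0 < ε') (hθ : 0 < θ)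
    (Cell : ℕ → ℕ → Finset γ) {V Λ : ℝ} (hV : 0 ≤ V) (hΛ : 0 < Λ)
    (hcell : ∀ K a, ((Cell K a).card : ℝ) ≤ V * Λ ^ a) (Dcap Ncap : ℕ → ℕ)
    (jstar : ℕ → ℕ) (hj : ∀ K, jstar K ≤ K) {c : ℝ} (hc : 0 < c)
    (hfrac : ∀ K : ℕ, c * K ≤ ((K - jstar K : ℕ) : ℝ)) {Δ : ℝ} (hΔ : 1 ≤ Δ)
    (hA : Regeneration l₀ π T A Bad' dead F Rf nlow nup Cn K₀)
    (hA' : Regeneration l₀ π T A' Bad' dead' F' Rf' mlow mup Cn K₀) (hCn : 0 ≤ Cn)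
    (R : ℕ → ℕ → ℕ) (g : ℕ → ℕ → ℝ) (β' : ℕ → ℝ)
    (h27 : ∀ K, K₀ ≤ K → B14.FlowIneq27 (g K) (β' K) β₀ C.p₀ K)
    (h29 : ∀ K, K₀ ≤ K → B14FlowStep.FlowIneq29 (R K) (g K) L (β' K) β₀ K)
    (hR : ∀ K, K₀ ≤ K → ∀ s, s ≤ K → B14.IsRj L rr (g K s) (R K s))
    (hx1 : ∀ K, K₀ ≤ K → ∀ s, s ≤ K → 1 ≤ Real.log ((g K s) ^ 2)⁻¹)
    (hir : ∀ K, K₀ ≤ K → irThresholdZTH sh C Kz p σ ε' θ L rr β₀ ≤ Real.log ((g K K) ^ 2)⁻¹)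
    (hP : ∀ K s, 0 ≤ p0Profile C.A₀ C.p₀ (g K s))
    {ηplus : ℝ} (hηplus : 0 ≤ ηplus) (hr : Λ * Real.exp (ηplus - C.κ₁) < 1)
    {Λ' : ℝ} (hΛ0 : 0 ≤ Λ') (h1 : Λ' * Real.exp ε' * Real.exp (-C.κ₁) * Real.exp ηplus < 1)
    (hx : (Real.exp (-C.E₀) + Real.exp (-C.E₀) * birthMass C *
          (Λ' * Real.exp ε' * Real.exp (-C.κ₁) / (1 - Λ' * Real.exp ε' * Real.exp (-C.κ₁) * Real.exp ηplus))) *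
          Real.exp ηplus ≤
        Real.exp ηplus - 1)
    {live : ℕ → κ → Finset (γ × Gen ε)}
    (H : LiveHistoriesZTH sh Gx C Kz p σ Λ' Δ l₀ K₀ R g Cell Dcap Ncap jstar Bad' F Rf F' Rf' live)
    (hSh : ShellWeightBound l₀ T A A' shA shB Wsh)
    (hTB : ReindexedBudget l₀ vol T (fun K t τ => A K t τ - shA K t τ) (fun K t τ => A' K t τ - shB K t τ)
      (badOfClass π T Bad') Cc Rr CcRec RrRec ν u s₂ c₀ r s)
    (hrs : Summable r) (hu : Summable u) (hs : Summable s) (hs₂ : Summable s₂) :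
    ∃ K₁ K₂, K₀ ≤ K₁ ∧ HybridNE7 l₀ vol (fun K => T (K₁ + (K₂ + K))) (fun K => A (K₁ + (K₂ + K)))
      (fun K => A' (K₁ + (K₂ + K))) (fun K => badOfClass π T Bad' (K₁ + (K₂ + K)))
      (fun K => Cn * recordsBudget (Δ * Real.exp (C.κ₁ * ((0 : ℕ) : ℝ)) * birthMass C) C.κ₁ V Λ ηplus jstar
        (K₁ + (K₂ + K)))
      (fun K => shA (K₁ + (K₂ + K))) (fun K => shB (K₁ + (K₂ + K))) (fun K => Wsh (K₁ + (K₂ + K)))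
      (fun K => (r (K₁ + (K₂ + K)) + u (K₁ + (K₂ + K))) + (s (K₁ + (K₂ + K)) + s₂ (K₁ + (K₂ + K)))) :=
  hybridNE7_of_eventually
    (relWeightBound_of_liveHistoriesZTH sh hGx h hμ₀ hKz hp h0 h1σ hε hθ Cell hV hΛ hcell Dcap Ncap jstar hj hc hfrac hΔ
      hA hA' hCn R g β' h27 h29 hR hx1 hir hP hηplus hr hΛ0 h1 hx H)
    hSh hTB hrs hu hs hs₂

end Exit

/-! ## §4 Sanity: the zone socket with no bad class -/

namespace Sanity

/-- With EMPTY bad classes every field of `LiveHistoriesZTH` holds for the empty live families. [folklore] -/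
example (C : T4PrintedShapeBanking.Consts) (Kz p σ Λ' Δ l₀ : ℝ) (K₀ : ℕ) (R : ℕ → ℕ → ℕ) (g : ℕ → ℕ → ℝ)
    (Cell : ℕ → ℕ → Finset ℕ) (Dcap Ncap jstar : ℕ → ℕ) (F Rf F' Rf' : ℕ → Unit → ℝ) :
    LiveHistoriesZTH (id : PEv → PEv) (fun _ _ => True) C Kz p σ Λ' Δ l₀ K₀ R g Cell Dcap Ncap jstar
      (fun _ _ => (∅ : Finset Unit)) F Rf F' Rf' (fun _ _ => (∅ : Finset (ℕ × Gen PEv))) where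
  consistent K q _ h := by obtain ⟨t, -, c, hc, -⟩ := h; simp at hc
  fresh K q _ h := by obtain ⟨t, -, c, hc, -⟩ := h; simp at hc
  generic K q _ h := by obtain ⟨t, -, c, hc, -⟩ := h; simp at hc
  pending K q _ h := by obtain ⟨t, -, c, hc, -⟩ := h; simp at hc
  cell_mem K q _ h := by obtain ⟨t, -, c, hc, -⟩ := h; simp at hc
  canon K q _ h := by obtain ⟨t, -, c, hc, -⟩ := h; simp at hc
  old K t _ _ c hc := by simp at hc
  slot_inj K t _ _ c hc := by simp at hc
  str_inj K t _ _ := by simp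
  price K t _ _ c hc := by simp at hc
  price' K t _ _ c hc := by simp at hc

end Sanity

end

end Summit.QuantumFields.BalabanUV.T4Continuum.HistorySocketZTH
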